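import Summits.AtomisticToContinuum.HydrodynamicLimit.Theorems.OneFlightGossipEngineClampedTransferDockCubicChannelRate
import Summits.AtomisticToContinuum.HydrodynamicLimit.Theorems.OneFlightGossipEngineSuperExponentialEnergyTailsDefsB
import HarnessLib

/-!
# Stub T1′ `stub_seetOfGevreyHierarchy` — the order after the level, Gevrey class `β < 2` (line `Sketch`,
# crux `SuperExponentialEnergyTails`, stmt-AtomisticToContinuum-17701)

Registered stub `stub_seetOfGevreyHierarchy : ∀ β, 0 < β → β < 2 → VelocityMomentGevreyHierarchy β → SEET` of
the lead's skeleton `Cruxes/SuperExponentialEnergyTails/Lines/Sketch.lean` (v2): the `k`-wise Gevrey velocity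
moment hierarchy `E_{λ₀}[(N+1)⁻¹ ∑ᵢ ‖vᵢ(s)‖^{2k}] ≤ C Aᵏ k^{βk}` for `N ≥ N₀(k)` (landed def
`Theorems.SuperExponentialEnergyTailsLine.VelocityMomentGevreyHierarchy`, p145291) implies, for every Gevrey
exponent `β < 2`, the super-exponential cubic velocity tail bound of the crux, in the form of its landed
byte-identical twin `Theorems.ClampedTransferDockCubicRate.SuperExponentialEnergyTails` (stretched-exponential
tails `exp (-K^{2/β})` beat every exponential rate `c`).

Proof ("choose the ORDER after the LEVEL", linear order): same `σ₀`; at rate `c` put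
`K₀ = max (max 1 C) ((e A (c + 5)^β)^{1/(2 - β)})`; for `K ≥ K₀` take the order `k = ⌈(c + 4) K⌉₊ (≥ 4)` and the
threshold `N₀ := N₀(k)` of the hierarchy.  Pointwise `‖v‖³ 1{‖v‖ > K} ≤ K³ / K^{2k} · ‖v‖^{2k}`
(`indicator_cube_le_pow`), so by linearity of the lower integral the cubic tail is at most
`K³/K^{2k} · C Aᵏ k^{βk}`, and (`level_order_bookkeeping`)
`K³/K^{2k} · C Aᵏ k^{βk} = C K³ (A k^β / K²)ᵏ ≤ C K³ e^{-k} ≤ e^{K} e^{3K} e^{-(c + 4) K} = e^{-cK}`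
from `k ≤ (c + 5) K`, `A (c + 5)^β K^β ≤ e^{-1} K²` (i.e. `e A (c+5)^β ≤ K^{2-β}`), `k ≥ (c + 4) K`, `C ≤ K ≤ e^K`.
The slack `ε` of the crux is not used.

prover-line-stmt-AtomisticToContinuum-17701-0 (stub worker `stub_seetOfGevreyHierarchy`).
-/

noncomputable section

namespace Summit.AtomisticToContinuum.HydrodynamicLimit.Theorems.SuperExponentialEnergyTailsSeetOfGevrey

open scoped BigOperators ENNReal
open MeasureTheory Set
open Literature.MathematicalPhysics.KineticTheory Literature.Analysis.FluidPDE
open Summit.AtomisticToContinuum.HydrodynamicLimit.Theorems.SuperExponentialEnergyTailsLine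
  (velMoment VelocityMomentGevreyHierarchy)

/-! ## §1 The pointwise domination of the cubic tail by an even moment -/

/-- **Cubic tail under an even moment**: for a level `K > 0` and an order `k ≥ 2`, pointwise
`‖v‖³ 1{‖v‖ > K} ≤ K³ / K^{2k} · ‖v‖^{2k}` (on `‖v‖ > K`, `K^{2k-3} ≤ ‖v‖^{2k-3}`). [folklore] -/
theorem indicator_cube_le_pow {K : ℝ} (hK : 0 < K) {k : ℕ} (hk : 2 ≤ k) (v : V3) :
    Set.indicator {w : V3 | K < ‖w‖} (fun w => ‖w‖ ^ 3) v ≤ K ^ 3 / K ^ (2 * k) * ‖v‖ ^ (2 * k) := by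
  by_cases hv : K < ‖v‖
  · rw [Set.indicator_of_mem (show v ∈ {w : V3 | K < ‖w‖} from hv), div_mul_eq_mul_div,
      le_div_iff₀ (pow_pos hK _)]
    obtain ⟨m, hm⟩ : ∃ m : ℕ, 2 * k = 3 + m := ⟨2 * k - 3, by omega⟩
    rw [hm, pow_add, pow_add]
    have h1 : K ^ m ≤ ‖v‖ ^ m := pow_le_pow_left₀ hK.le hv.le m
    have h2 : 0 ≤ ‖v‖ ^ 3 * K ^ 3 := by positivity
    calc ‖v‖ ^ 3 * (K ^ 3 * K ^ m) = (‖v‖ ^ 3 * K ^ 3) * K ^ m := by ring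
      _ ≤ (‖v‖ ^ 3 * K ^ 3) * ‖v‖ ^ m := mul_le_mul_of_nonneg_left h1 h2
      _ = K ^ 3 * (‖v‖ ^ 3 * ‖v‖ ^ m) := by ring
  · rw [Set.indicator_of_notMem (show v ∉ {w : V3 | K < ‖w‖} from hv)]
    positivity

/-! ## §2 The level/order bookkeeping -/

/-- **The order after the level, real bookkeeping (Gevrey class)**: for `0 < β < 2`, `A, c > 0`, `C ≥ 0`,
`K ≥ max 1 C` and `K ≥ (e A (c + 5)^β)^{1/(2-β)}`, with the linear order `k = ⌈(c + 4) K⌉₊`,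
`K³ / K^{2k} · (C Aᵏ k^{βk}) ≤ e^{-cK}` — from `k^{βk} = (k^β)ᵏ`, `k ≤ (c + 5) K`, `e A (c + 5)^β ≤ K^{2-β}` (so
`A k^β ≤ K² e^{-1}`), `k ≥ (c + 4) K`, `C ≤ K ≤ e^K` and `K³ ≤ e^{3K}`. [folklore] -/
theorem level_order_bookkeeping {β A C c K : ℝ} (hβ0 : 0 < β) (hβ2 : β < 2) (hA : 0 < A) (hC : 0 ≤ C)
    (hc : 0 < c) (h1 : 1 ≤ K) (hCK : C ≤ K)
    (hAK : (Real.exp 1 * A * (c + 5) ^ β) ^ (2 - β)⁻¹ ≤ K) :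
    K ^ 3 / K ^ (2 * ⌈(c + 4) * K⌉₊) *
        (C * A ^ ⌈(c + 4) * K⌉₊ * ((⌈(c + 4) * K⌉₊ : ℕ) : ℝ) ^ (β * (⌈(c + 4) * K⌉₊ : ℕ))) ≤
      Real.exp (-(c * K)) := by
  set k : ℕ := ⌈(c + 4) * K⌉₊ with hk
  have hK : 0 < K := one_pos.trans_le h1
  have hc4 : 0 ≤ (c + 4) * K := by positivity
  have hkge : (c + 4) * K ≤ k := Nat.le_ceil _
  have hklt : (k : ℝ) < (c + 4) * K + 1 := Nat.ceil_lt_add_one hc4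
  have hk0 : (0 : ℝ) ≤ k := Nat.cast_nonneg k
  have hkle : (k : ℝ) ≤ (c + 5) * K := by nlinarith
  -- `k^{βk} = (k^β)^k`
  have hpow : (k : ℝ) ^ (β * (k : ℕ)) = ((k : ℝ) ^ β) ^ k := by
    rw [Real.rpow_mul hk0, Real.rpow_natCast]
  -- `A k^β ≤ K² e^{-1}`
  have hB0 : 0 ≤ Real.exp 1 * A * (c + 5) ^ β := by positivity
  have hδ : (2 - β) ≠ 0 := by linarith
  have hK2β : Real.exp 1 * A * (c + 5) ^ β ≤ K ^ (2 - β) := by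
    calc Real.exp 1 * A * (c + 5) ^ β
        = ((Real.exp 1 * A * (c + 5) ^ β) ^ (2 - β)⁻¹) ^ (2 - β) := (Real.rpow_inv_rpow hB0 hδ).symm
      _ ≤ K ^ (2 - β) := Real.rpow_le_rpow (Real.rpow_nonneg hB0 _) hAK (by linarith)
  have hkβ : (k : ℝ) ^ β ≤ (c + 5) ^ β * K ^ β := by
    rw [← Real.mul_rpow (by positivity) hK.le]
    exact Real.rpow_le_rpow hk0 hkle hβ0.le
  have hAk : A * (k : ℝ) ^ β ≤ K ^ 2 * Real.exp (-1) := by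
    have hK2 : (K ^ 2 : ℝ) = K ^ β * K ^ (2 - β) := by
      rw [← Real.rpow_add hK, ← Real.rpow_two]; ring_nf
    calc A * (k : ℝ) ^ β ≤ A * ((c + 5) ^ β * K ^ β) := mul_le_mul_of_nonneg_left hkβ hA.le
      _ = Real.exp (-1) * (Real.exp 1 * A * (c + 5) ^ β) * K ^ β := by
          rw [Real.exp_neg]; field_simp
      _ ≤ Real.exp (-1) * K ^ (2 - β) * K ^ β := by gcongr
      _ = K ^ 2 * Real.exp (-1) := by rw [hK2]; ring
  have hAkpow : (A * (k : ℝ) ^ β) ^ k ≤ (K ^ 2) ^ k * Real.exp (-1) ^ k := by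
    rw [← mul_pow]
    exact pow_le_pow_left₀ (by positivity) hAk k
  -- `C K³ e^{-k} ≤ e^{-cK}`
  have hkey : C * K ^ 3 * Real.exp (-1) ^ k ≤ Real.exp (-(c * K)) := by
    have hKexp : K ≤ Real.exp K := by linarith [Real.add_one_le_exp K]
    have hCexp : C ≤ Real.exp K := hCK.trans hKexp
    have hK3 : K ^ 3 ≤ Real.exp (3 * K) := by
      calc K ^ 3 ≤ Real.exp K ^ 3 := pow_le_pow_left₀ hK.le hKexp 3
        _ = Real.exp (3 * K) := by rw [← Real.exp_nat_mul]; norm_num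
    have hEk : Real.exp (-1) ^ k ≤ Real.exp (-((c + 4) * K)) := by
      rw [← Real.exp_nat_mul]
      exact Real.exp_le_exp.2 (by linarith)
    calc C * K ^ 3 * Real.exp (-1) ^ k
        ≤ Real.exp K * Real.exp (3 * K) * Real.exp (-((c + 4) * K)) := by
          have h3 : 0 ≤ Real.exp (-1) ^ k := by positivity
          have hCK3 : C * K ^ 3 ≤ Real.exp K * Real.exp (3 * K) :=
            calc C * K ^ 3 ≤ Real.exp K * K ^ 3 := mul_le_mul_of_nonneg_right hCexp (by positivity)
              _ ≤ Real.exp K * Real.exp (3 * K) := mul_le_mul_of_nonneg_left hK3 (Real.exp_pos K).le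
          exact mul_le_mul hCK3 hEk h3 (by positivity)
      _ = Real.exp (K + 3 * K + -((c + 4) * K)) := by rw [Real.exp_add, Real.exp_add]
      _ = Real.exp (-(c * K)) := by ring_nf
  -- assemble
  rw [hpow, div_mul_eq_mul_div, div_le_iff₀ (pow_pos hK _)]
  calc K ^ 3 * (C * A ^ k * ((k : ℝ) ^ β) ^ k)
      = C * K ^ 3 * (A * (k : ℝ) ^ β) ^ k := by rw [mul_pow]; ring
    _ ≤ C * K ^ 3 * ((K ^ 2) ^ k * Real.exp (-1) ^ k) :=
        mul_le_mul_of_nonneg_left hAkpow (by positivity)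
    _ = C * K ^ 3 * Real.exp (-1) ^ k * K ^ (2 * k) := by rw [pow_mul]; ring
    _ ≤ Real.exp (-(c * K)) * K ^ (2 * k) := mul_le_mul_of_nonneg_right hkey (by positivity)

/-! ## §3 The stub -/

/-- **Stub T1′ — order after level, Gevrey class `β < 2`** (registered stub `stub_seetOfGevreyHierarchy` of line
Sketch, crux SuperExponentialEnergyTails, stmt-AtomisticToContinuum-17701).
`VelocityMomentGevreyHierarchy β → SEET` for `0 < β < 2`: same `σ₀`; at rate `c` take
`K₀ = max (max 1 C) ((e A (c + 5)^β)^{1/(2-β)})`; for `K ≥ K₀` take the linear order `k = ⌈(c + 4) K⌉₊ (≥ 4)` and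
`N₀ := N₀(k)`; pointwise `‖v‖³ 1{‖v‖ > K} ≤ K³/K^{2k} ‖v‖^{2k}`, so the cubic tail is at most
`K³/K^{2k} · C Aᵏ k^{βk} ≤ e^{-cK}`; the slack `ε` is unused.  The conclusion is the LANDED byte-identical twin
`Theorems.ClampedTransferDockCubicRate.SuperExponentialEnergyTails` of the route decl. -/
theorem stub_seetOfGevreyHierarchy : ∀ β : ℝ, 0 < β → β < 2 → VelocityMomentGevreyHierarchy β → Summit.AtomisticToContinuum.HydrodynamicLimit.Theorems.ClampedTransferDockCubicRate.SuperExponentialEnergyTails := by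
  intro β hβ0 hβ2 h a₀ θ₀ u₀ ha hθ hu ha0 hθ0
  obtain ⟨σ₀, hσ₀, H⟩ := h a₀ θ₀ u₀ ha hθ hu ha0 hθ0
  refine ⟨σ₀, hσ₀, fun σ hσ hσlt T ρ θ u hE Φ htie t ht c hc => ?_⟩
  obtain ⟨A, hA, C, hC, HK⟩ := H σ hσ hσlt T ρ θ u hE Φ htie t ht
  refine ⟨max (max 1 C) ((Real.exp 1 * A * (c + 5) ^ β) ^ (2 - β)⁻¹),
    lt_of_lt_of_le one_pos ((le_max_left _ _).trans (le_max_left _ _)), fun K hK ε hε => ?_⟩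
  have h1 : 1 ≤ K := ((le_max_left _ _).trans (le_max_left _ _)).trans hK
  have hCK : C ≤ K := ((le_max_right _ _).trans (le_max_left _ _)).trans hK
  have hAK : (Real.exp 1 * A * (c + 5) ^ β) ^ (2 - β)⁻¹ ≤ K := (le_max_right _ _).trans hK
  have hKpos : 0 < K := one_pos.trans_le h1
  -- the order after the level
  set k : ℕ := ⌈(c + 4) * K⌉₊ with hk
  have hk2 : 2 ≤ k := by
    have hkge : (c + 4) * K ≤ k := Nat.le_ceil _
    have h4 : (4 : ℝ) ≤ (c + 4) * K := by nlinarith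
    exact_mod_cast (show (2 : ℝ) ≤ k by linarith)
  obtain ⟨N₀, HN⟩ := HK k
  refine ⟨N₀, fun N hN s hs => ?_⟩
  -- the constant and the real bookkeeping
  set M : ℝ := K ^ 3 / K ^ (2 * k) with hM
  have hM0 : 0 ≤ M := by positivity
  have hreal : M * (C * A ^ k * (k : ℝ) ^ (β * k)) ≤ Real.exp (-(c * K)) :=
    level_order_bookkeeping hβ0 hβ2 hA hC.le hc h1 hCK hAK
  -- the hierarchy at order `k`
  have hmom : ∫⁻ z, ENNReal.ofReal (((N : ℝ) + 1)⁻¹ * ∑ i : Fin (N + 1),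
        ‖((Φ N).flow s z i).2‖ ^ (2 * k)) ∂(localGibbsLaw σ a₀ u₀ θ₀ N (Φ N)) ≤
      ENNReal.ofReal (C * A ^ k * (k : ℝ) ^ (β * k)) := HN N hN s hs
  -- pointwise domination of the integrand
  have hpt : ∀ z : Config (N + 1) (Fin 3) T3,
      ENNReal.ofReal (((N : ℝ) + 1)⁻¹ * ∑ i : Fin (N + 1),
        Set.indicator {v : V3 | K < ‖v‖} (fun v => ‖v‖ ^ 3) (((Φ N).flow s z i).2)) ≤
      ENNReal.ofReal M * ENNReal.ofReal (((N : ℝ) + 1)⁻¹ * ∑ i : Fin (N + 1),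
        ‖((Φ N).flow s z i).2‖ ^ (2 * k)) := by
    intro z
    rw [← ENNReal.ofReal_mul hM0]
    refine ENNReal.ofReal_le_ofReal ?_
    calc ((N : ℝ) + 1)⁻¹ * ∑ i : Fin (N + 1),
          Set.indicator {v : V3 | K < ‖v‖} (fun v => ‖v‖ ^ 3) (((Φ N).flow s z i).2)
        ≤ ((N : ℝ) + 1)⁻¹ * ∑ i : Fin (N + 1), M * ‖((Φ N).flow s z i).2‖ ^ (2 * k) :=
          mul_le_mul_of_nonneg_left (Finset.sum_le_sum fun i _ => indicator_cube_le_pow hKpos hk2 _)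
            (by positivity)
      _ = M * (((N : ℝ) + 1)⁻¹ * ∑ i : Fin (N + 1), ‖((Φ N).flow s z i).2‖ ^ (2 * k)) := by
          rw [← Finset.mul_sum]
          ring
  -- linearity of the lower integral and the hierarchy at order `k`
  calc ∫⁻ z, ENNReal.ofReal (((N : ℝ) + 1)⁻¹ * ∑ i : Fin (N + 1),
          Set.indicator {v : V3 | K < ‖v‖} (fun v => ‖v‖ ^ 3) (((Φ N).flow s z i).2))
          ∂(localGibbsLaw σ a₀ u₀ θ₀ N (Φ N))
      ≤ ∫⁻ z, ENNReal.ofReal M * ENNReal.ofReal (((N : ℝ) + 1)⁻¹ * ∑ i : Fin (N + 1),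
          ‖((Φ N).flow s z i).2‖ ^ (2 * k)) ∂(localGibbsLaw σ a₀ u₀ θ₀ N (Φ N)) := lintegral_mono (hpt ·)
    _ = ENNReal.ofReal M * ∫⁻ z, ENNReal.ofReal (((N : ℝ) + 1)⁻¹ * ∑ i : Fin (N + 1),
          ‖((Φ N).flow s z i).2‖ ^ (2 * k)) ∂(localGibbsLaw σ a₀ u₀ θ₀ N (Φ N)) :=
        lintegral_const_mul' _ _ ENNReal.ofReal_ne_top
    _ ≤ ENNReal.ofReal M * ENNReal.ofReal (C * A ^ k * (k : ℝ) ^ (β * k)) := mul_le_mul' le_rfl hmom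
    _ = ENNReal.ofReal (M * (C * A ^ k * (k : ℝ) ^ (β * k))) := (ENNReal.ofReal_mul hM0).symm
    _ ≤ ENNReal.ofReal (Real.exp (-(c * K))) := ENNReal.ofReal_le_ofReal hreal
    _ ≤ ENNReal.ofReal (Real.exp (-(c * K)) + ε) := ENNReal.ofReal_le_ofReal (by linarith)

end Summit.AtomisticToContinuum.HydrodynamicLimit.Theorems.SuperExponentialEnergyTailsSeetOfGevrey

end
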